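import Literature.Barriers.Parity.MaierMatrix
import Literature.NumberTheory.LFunctions.PageUniformPNT
import Literature.NumberTheory.Sieve.MaierSieveOscillation
import HarnessLib

/-!
# Maier's theorem on primes in short intervals `(x, x + (log x)^A]` — the proof

Topic `Literature/Barriers/Parity` (proof companion of `EquidistributionLimits.lean` for Maier's
theorem; the sibling `EquidistributionLimitsProofs.lean` discharges the barrier record
`EquidistributionLimitBarrier` and is independent of this file). Everything in this file is PROVED;
it discharges the named fact
`Literature.Barriers.Parity.Maier1985_shortIntervals` (Maier 1985, in the two-sided form printed by
Granville 2010, §4 p. 12: for every `A > 2` there is `δ_A > 0` with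
`π(x + log^A x) − π(x) ≥ (1 + δ_A) log^{A−1} x` and `π(X + log^A X) − π(X) ≤ (1 − δ_A) log^{A−1} X`
for arbitrarily large integers `x`, `X`) as `Maier1985_shortIntervals_holds`.

## The argument (Maier's matrix method, with Page's theorem for the columns)

The mechanics of the matrix (rows, columns, double counting, pigeonhole, the elementary
asymptotics and Mertens' theorem in a window) are in `Literature/Barriers/Parity/MaierMatrix.lean`
(namespace `Literature.Barriers.Parity.Maier`); the sieve-theoretic count of the admissible
columns is `Literature/NumberTheory/Sieve/MaierSieveOscillation.lean`; the prime number theorem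
for the columns is `Literature/NumberTheory/LFunctions/PageUniformPNT.lean`. This file fixes the
parameters (`Maier.matrix_rows`) and concludes (`Maier1985_shortIntervals_holds`).

We follow Maier's "matrix method" in the arrangement of Soundararajan's lectures
(`Soundararajan2007Distribution`, Lecture 3): for a modulus `P = ∏_{p ∈ S} p` and a width `h`
consider the integers `rP + j`, `N/P < r ≤ 2N/P`, `1 ≤ j ≤ h`. Counting the primes among them
by columns (arithmetic progressions `j mod P`, prime number theorem for progressions) and by rows
(intervals `(rP, rP + h]`) shows that some row contains at least, and some row at most,
`(N_S(h)/ (h W(S))) · h/log N · (1 + o(1))` primes, where `N_S(h) = #{j ≤ h : (j, P) = 1}` and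
`W(S) = φ(P)/P`; and `N_S(h)/(hW(S))` is bounded away from `1`, from above or from below according
to the parity of the number `k` of prime factors from `S` that an integer `≤ h` can have
(`Literature/NumberTheory/Sieve/MaierSieveOscillation.lean`). The ingredients:

* **Columns.** `Literature.NumberTheory.LFunctions.PageUniformPNT.chebyshevPsiMod_uniform` (the
  tree's Page-type prime number theorem: `ψ(x; q, a) = (1 + O(ε)) x/φ(q)` uniformly for
  `log q ≤ (log x)^b`, `b < 1/4`, `q` coprime to one exceptional prime `B(x)`), applied at `x = N`
  and `x = 2N`; the (at most two) exceptional primes are simply deleted from `S` — Maier needed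
  "good" moduli in the sense of Gallagher, here Page's theorem with one prime removed
  (Ford–Maynard–Tao, §2) plays that role, which restricts `P` to `log P ≤ (log N)^{1/4−}` and is
  the reason for the large number `k + 1 > 4A` of prime factors below. The passage from `ψ` to
  prime counts in a column (`column_bounds`) uses only Chebyshev's `ψ(x) − ϑ(x) ≤ 2√x log x`
  (Mathlib) and the sandwich `ϑ(x; q, a) ≤ ψ(x; q, a) ≤ ϑ(x; q, a) + (ψ(x) − ϑ(x))` of the tree
  (`Literature.NumberTheory.Sieve.sum_log_prime_modEq_le_chebyshevPsiMod`).
* **Rows vs columns.** `sum_rows_eq_sum_columns` (double counting), `card_column_eq_zero`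
  (columns `j` with `(j, P) > 1` contain no primes), `exists_row_ge` / `exists_row_le`
  (pigeonhole over the `⌊2N/P⌋ − ⌊N/P⌋ = (N/P)(1 + O(P/N))` rows).
* **The sieve side.** With `L = log N`, `S` = the primes of `(L^c, L^{b'}]` (minus the exceptional
  ones), `A/(k+1) < c < b' < A/k`: every product of `k + 1` primes of `S` exceeds `h ≍ L^A` while
  `(#S + 1)^k = o(h)`, so Legendre's formula for `N_S(h)` truncates exactly after `k`-fold products
  and `N_S(h) = hW(1 ± e_{k+1}(S) …)` with the sign `(−1)^k`
  (`Literature.NumberTheory.Sieve.MaierMatrix.siftedCount_ge_of_even` / `…_le_of_odd`); Mertens'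
  theorem (tree: `Literature.NumberTheory.LFunctions.Mertens.tendsto_primeRecipSum_sub_loglog`)
  gives `∑_{p ∈ S} 1/p → log(b'/c) ∈ (0, log 2)`, whence `e_{k+1}(S) ≥ η(A, k) > 0` and
  `W(S) ≥ 1/5`.
* **Assembly.** `matrix_rows` fixes the parameters and produces, for all large `N` and all widths
  `h ∈ [L^A − 1, (L + 1)^A + 1]`, rows `x ∈ (N, 2N]` with `≥ h(1 + η/4)/log(3N)` (even `k`) resp.
  `≤ h(1 − η/4)/log N` (odd `k`) primes in `(x, x + h]`; `Maier1985_shortIntervals_holds` takes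
  `h = ⌊L^A⌋` resp. `h = ⌈log^A(2N)⌉` and compares with `log^{A−1} x`, `x ∈ (N, 2N]`
  (`eventually_lengths_le`).

What is NOT proved here: Maier's sharper statement with the Buchstab function
(`limsup ≥ e^γ ω(A)`-type constants) and the range `1 < A ≤ 2`; the constant `δ_A` obtained is
`min(η₁, η₂)/16` with `η = (log(b'/c)/2)^{k+1}/(k+1)!`, far from optimal.

## References

* H. Maier, *Primes in short intervals*, Michigan Math. J. 32 (1985), 221–225 (`Maier1985`).
* K. Soundararajan, *The distribution of prime numbers*, in: Equidistribution in number theory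
  (Springer 2007), arXiv:math/0606408, Lecture 3 (`Soundararajan2007Distribution`).
* A. Granville, *Different approaches to the distribution of primes*, Milan J. Math. 78 (2010),
  §4 p. 12 (`Granville2010DifferentApproaches`) — the printed form of the statement.
* H. L. Montgomery, R. C. Vaughan, *Multiplicative Number Theory I* (CUP 2007), proof of
  Cor. 11.20 (`MontgomeryVaughan2007`) — the `ϑ/ψ` sandwich in progressions.
* K. Ford, J. Maynard, T. Tao, *Chains of large gaps between primes* (2018), §2–3
  (`FordMaynardTao2018`) — Page's theorem with one exceptional prime removed, in a Maier matrix.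
-/

noncomputable section

open Filter Finset
open scoped ArithmeticFunction.vonMangoldt

namespace Literature.Barriers.Parity.Maier

open Literature.NumberTheory.Sieve.ParityWave0 (chebyshevPsiMod)
open Literature.NumberTheory.Sieve.MaierMatrix

/-! ## The matrix with Maier's parameters -/

/-- `log 2 < 7/10`. [folklore] -/
theorem log_two_lt : Real.log 2 < 7 / 10 := by
  have := Real.log_two_lt_d9; linarith

/-- The final arithmetic of the even case: from `N_S(h) ≥ hW(1+e) − Err` with `e ≥ η`,
`Err ≤ ηh/40`, `W ≥ 1/5`, `ε = η/100` (`η ≤ 1`), conclude `h(1 + η/4) ≤ (N_S(h)/W)(1 − 5ε)`. [folklore] -/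
theorem even_endgame {h η W e Err Nc : ℝ} (hh : 0 < h) (hη0 : 0 < η) (hη1 : η ≤ 1)
    (hW5 : 1 / 5 ≤ W) (he : η ≤ e) (hErr : Err ≤ η / 40 * h)
    (hsift : h * W * (1 + e) - Err ≤ Nc) :
    h * (1 + η / 4) ≤ Nc * W⁻¹ * (1 - 5 * (η / 100)) := by
  have hW0 : 0 < W := by linarith
  have hhW : 0 ≤ h * W := by positivity
  have h2 : h * W * (1 + η) ≤ h * W * (1 + e) := by nlinarith
  have h3 : Err ≤ η / 8 * h * W :=
    calc Err ≤ η / 40 * h := hErr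
      _ = η / 8 * h * (1 / 5) := by ring
      _ ≤ η / 8 * h * W := mul_le_mul_of_nonneg_left hW5 (by positivity)
  have h1 : h * (1 + η) - η / 8 * h ≤ Nc * W⁻¹ := by
    rw [← div_eq_mul_inv, le_div_iff₀ hW0]
    nlinarith
  have h4 : 0 ≤ 1 - 5 * (η / 100) := by linarith
  have key : 0 ≤ ((1 + η) - η / 8) * (1 - 5 * (η / 100)) - (1 + η / 4) := by nlinarith
  calc h * (1 + η / 4) ≤ (h * (1 + η) - η / 8 * h) * (1 - 5 * (η / 100)) := by
        have : (h * (1 + η) - η / 8 * h) * (1 - 5 * (η / 100)) - h * (1 + η / 4) =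
            h * (((1 + η) - η / 8) * (1 - 5 * (η / 100)) - (1 + η / 4)) := by ring
        nlinarith [mul_nonneg hh.le key]
    _ ≤ Nc * W⁻¹ * (1 - 5 * (η / 100)) := mul_le_mul_of_nonneg_right h1 h4

/-- The final arithmetic of the odd case: from `N_S(h) ≤ hW(1−e) + Err` with `e ≥ η`,
`Err ≤ ηh/40`, `W ≥ 1/5`, `ε = η/100`, conclude `(N_S(h)/W)(1 + 7ε) ≤ h(1 − η/4)`. [folklore] -/
theorem odd_endgame {h η W e Err Nc : ℝ} (hh : 0 < h) (hη0 : 0 < η)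
    (hW5 : 1 / 5 ≤ W) (he : η ≤ e) (hErr : Err ≤ η / 40 * h)
    (hsift : Nc ≤ h * W * (1 - e) + Err) :
    Nc * W⁻¹ * (1 + 7 * (η / 100)) ≤ h * (1 - η / 4) := by
  have hW0 : 0 < W := by linarith
  have hhW : 0 ≤ h * W := by positivity
  have h2 : h * W * (1 - e) ≤ h * W * (1 - η) := by nlinarith
  have h3 : Err ≤ η / 8 * h * W :=
    calc Err ≤ η / 40 * h := hErr
      _ = η / 8 * h * (1 / 5) := by ring
      _ ≤ η / 8 * h * W := mul_le_mul_of_nonneg_left hW5 (by positivity)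
  have h1 : Nc * W⁻¹ ≤ h * (1 - η) + η / 8 * h := by
    rw [← div_eq_mul_inv, div_le_iff₀ hW0]
    nlinarith
  have key : 0 ≤ (1 - η / 4) - ((1 - η) + η / 8) * (1 + 7 * (η / 100)) := by nlinarith
  calc Nc * W⁻¹ * (1 + 7 * (η / 100)) ≤ (h * (1 - η) + η / 8 * h) * (1 + 7 * (η / 100)) :=
        mul_le_mul_of_nonneg_right h1 (by positivity)
    _ ≤ h * (1 - η / 4) := by
        have : h * (1 - η / 4) - (h * (1 - η) + η / 8 * h) * (1 + 7 * (η / 100)) =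
            h * ((1 - η / 4) - ((1 - η) + η / 8) * (1 + 7 * (η / 100))) := by ring
        nlinarith [mul_nonneg hh.le key]

set_option maxHeartbeats 3200000 in
/-- **Maier's matrix with Page's theorem.** Fix `A > 2` and `k` with `k + 1 > 4A`. There is
`η = η(A, k) ∈ (0, 1]` such that for all large `N` and every width `h` with
`(log N)^A − 1 ≤ h ≤ (log N + 1)^A + 1` there are integers `x, X ∈ (N, 2N]` (rows `x = rP` of the
matrix) with `#{primes in (x, x+h]} ≥ h(1 + η/4)/log(3N)` if `k` is even, and
`#{primes in (X, X+h]} ≤ h(1 − η/4)/log N` if `k` is odd. Construction: `L = log N`,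
`t = A/(k+1)`, `g = min(A/k − t, 1/4 − t)`, `c = t + g/4 < b' = t + g/2 < b'' = t + 3g/4 < 1/4`;
`S` = primes in `(L^c, L^{b'}]` minus the (at most two) exceptional primes of
`Literature.NumberTheory.LFunctions.PageUniformPNT.chebyshevPsiMod_uniform` at `N` and `2N`
(exponent `b''`, accuracy `ε = η/100`), `P = ∏ S ≤ 4^{L^{b'}} ≤ exp(L^{b''})`; the sieve side is
`Literature.NumberTheory.Sieve.MaierMatrix.siftedCount_ge_of_even` / `…_le_of_odd` with
`w = L^c` (every `(k+1)`-fold product exceeds `h`), Mertens' theorem giving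
`∑_{p∈S} 1/p → log(b'/c) ∈ (0, log 2)`, and the rows are found by `exists_row_ge` / `exists_row_le`.
[cite: Maier1985, Theorem (proof via the matrix method)] [cite: Soundararajan2007Distribution, Lecture 3, Exercise 11] -/
theorem matrix_rows {A : ℝ} (hA : 2 < A) {k : ℕ} (hk : 4 * A < k + 1) :
    ∃ η : ℝ, 0 < η ∧ η ≤ 1 ∧ ∀ᶠ N : ℕ in atTop, ∀ h : ℕ, 1 ≤ h →
      (h : ℝ) ≤ (Real.log N + 1) ^ A + 1 → Real.log N ^ A - 1 ≤ h →
      (Even k → ∃ x : ℕ, N < x ∧ x ≤ 2 * N ∧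
        (h : ℝ) * (1 + η / 4) / Real.log (3 * N) ≤ #{i ∈ range h | (x + (i + 1)).Prime}) ∧
      (Odd k → ∃ x : ℕ, N < x ∧ x ≤ 2 * N ∧
        (#{i ∈ range h | (x + (i + 1)).Prime} : ℝ) ≤ h * (1 - η / 4) / Real.log N) := by
  classical
  -- ### constants
  have hA0 : 0 < A := by linarith
  have hk8 : (8 : ℝ) < k + 1 := by linarith
  have hk7 : 7 ≤ k := by
    have : (7 : ℝ) < k := by linarith
    exact_mod_cast this.le
  have hkpos : (0 : ℝ) < k := by exact_mod_cast (by omega : 0 < k)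
  have hk1pos : (0 : ℝ) < k + 1 := by linarith
  set t : ℝ := A / (k + 1) with htdef
  have ht0 : 0 < t := div_pos hA0 hk1pos
  have ht4 : t < 1 / 4 := by rw [htdef, div_lt_iff₀ hk1pos]; linarith
  have htk : t < A / k := by
    rw [htdef]
    exact div_lt_div_of_pos_left hA0 hkpos (by linarith)
  set g : ℝ := min (A / k - t) (1 / 4 - t) with hgdef
  have hg0 : 0 < g := lt_min (by linarith) (by linarith)
  have hg1 : g ≤ A / k - t := min_le_left _ _
  have hg2 : g ≤ 1 / 4 - t := min_le_right _ _
  set c : ℝ := t + g / 4 with hcdef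
  set b' : ℝ := t + g / 2 with hb'def
  set b'' : ℝ := t + 3 * g / 4 with hb''def
  have hc0 : 0 < c := by rw [hcdef]; positivity
  have hcb' : c < b' := by rw [hcdef, hb'def]; linarith
  have hb'b'' : b' < b'' := by rw [hb'def, hb''def]; linarith
  have hb''4 : b'' < 1 / 4 := by rw [hb''def]; linarith
  have hb'0 : 0 < b' := by linarith
  have hb''0 : 0 < b'' := by linarith
  have hb'k : b' * k < A := by
    have : b' < A / k := by rw [hb'def]; linarith
    rwa [lt_div_iff₀ hkpos] at this
  have hck : A < c * (k + 1) := by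
    have : t < c := by rw [hcdef]; linarith
    have := mul_lt_mul_of_pos_right this hk1pos
    rwa [htdef, div_mul_cancel₀ _ hk1pos.ne'] at this
  set ℓ : ℝ := Real.log b' - Real.log c with hℓdef
  have hℓ0 : 0 < ℓ := by rw [hℓdef]; linarith [Real.log_lt_log hc0 hcb']
  have hℓ7 : ℓ < 7 / 10 := by
    have h2 : b' < 2 * c := by rw [hcdef, hb'def]; linarith
    have : Real.log b' < Real.log (2 * c) := Real.log_lt_log hb'0 h2
    rw [Real.log_mul two_ne_zero hc0.ne'] at this
    rw [hℓdef]; linarith [log_two_lt]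
  set η : ℝ := (ℓ / 2) ^ (k + 1) / (k + 1).factorial with hηdef
  have hη0 : 0 < η := by rw [hηdef]; positivity
  have hη1 : η ≤ 1 := by
    rw [hηdef, div_le_one (by exact_mod_cast (k + 1).factorial_pos)]
    calc (ℓ / 2) ^ (k + 1) ≤ 1 ^ (k + 1) := pow_le_pow_left₀ (by linarith) (by linarith) _
      _ = 1 := one_pow _
      _ ≤ (k + 1).factorial := by exact_mod_cast (k + 1).factorial_pos
  set ε : ℝ := η / 100 with hεdef
  have hε0 : 0 < ε := by rw [hεdef]; positivity
  have hε8 : ε ≤ 1 / 8 := by rw [hεdef]; linarith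
  -- ### Page's uniform prime number theorem at accuracy `ε`, exponent `b''`
  obtain ⟨X₀, hX₀⟩ := Literature.NumberTheory.LFunctions.PageUniformPNT.chebyshevPsiMod_uniform hb''0 hb''4 hε0
  refine ⟨η, hη0, hη1, ?_⟩
  -- ### the conditions on `L = log N`
  have hlog4 : 0 < Real.log 4 := Real.log_pos (by norm_num)
  have Q1 : ∀ᶠ L : ℝ in atTop, Real.log 4 * (L ^ b' + 1) ≤ L ^ b'' := by
    filter_upwards [eventually_const_mul_rpow_le (C := 2 * Real.log 4) hb'b'' one_pos,
      (tendsto_rpow_atTop hb'0).eventually_ge_atTop 1] with L h1 h2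
    nlinarith only [h1, h2, hlog4]
  have Q2 : ∀ᶠ L : ℝ in atTop, 2 * (k + 3) / ℓ ≤ L ^ c ∧ 16 / ℓ ≤ L ^ c ∧ 4 * k / ℓ ≤ L ^ c ∧ 1 ≤ L ^ c :=
    ((tendsto_rpow_atTop hc0).eventually_ge_atTop _).and
      (((tendsto_rpow_atTop hc0).eventually_ge_atTop _).and
        (((tendsto_rpow_atTop hc0).eventually_ge_atTop _).and
          ((tendsto_rpow_atTop hc0).eventually_ge_atTop _)))
  have Q3 : ∀ᶠ L : ℝ in atTop, (L + 1) ^ A + 1 ≤ L ^ (c * (k + 1)) := by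
    filter_upwards [eventually_add_rpow_le (A := A) zero_le_one one_lt_two,
      eventually_const_mul_rpow_le (C := 3) hck one_pos,
      (tendsto_rpow_atTop hA0).eventually_ge_atTop 1] with L h1 h2 h3
    linarith
  have Q4 : ∀ᶠ L : ℝ in atTop, 4 * L ^ b'' ≤ L := by
    filter_upwards [eventually_const_mul_rpow_le (C := 4) (by linarith : b'' < 1) one_pos,
      eventually_ge_atTop (0 : ℝ)] with L h1 h2
    rwa [Real.rpow_one, one_mul] at h1
  have Q5 : ∀ᶠ L : ℝ in atTop, 2 / ε ≤ Real.exp (3 * L / 4) :=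
    (Real.tendsto_exp_atTop.comp (tendsto_id.const_mul_atTop (by norm_num : (0 : ℝ) < 3 / 4))).eventually_ge_atTop
      _ |>.mono fun L hL ↦ by simpa [mul_comm, mul_div_assoc] using hL
  have Q6 : ∀ᶠ L : ℝ in atTop, 3 * Real.sqrt 3 * (L + Real.log 3) ≤ ε * Real.exp (L / 4) :=
    eventually_linear_le_exp (by positivity) hε0
  have Q7 : ∀ᶠ L : ℝ in atTop,
      |Literature.NumberTheory.LFunctions.Mertens.primeRecipSum (L ^ b') -
          Literature.NumberTheory.LFunctions.Mertens.primeRecipSum (L ^ c) - ℓ| ≤ ℓ / 8 :=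
    eventually_abs_primeRecipSum_window hc0 hb'0 (by positivity)
  have Q8 : ∀ᶠ L : ℝ in atTop, (k + 1) * (L ^ b' + 2) ^ k ≤ η / 40 * (L ^ A - 1) ∧ 2 ≤ L ^ b' := by
    have hb'kA : b' * k < A := hb'k
    filter_upwards [eventually_const_mul_rpow_le (C := (k + 1) * 2 ^ k + η / 40) hb'kA (by positivity : 0 < η / 40),
      (tendsto_rpow_atTop hb'0).eventually_ge_atTop 2, eventually_gt_atTop (0 : ℝ)] with L h1 h2 hL0
    refine ⟨?_, h2⟩
    have h3 : (L ^ b' + 2) ^ k ≤ (2 * L ^ b') ^ k := pow_le_pow_left₀ (by positivity) (by linarith) k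
    have h4 : (2 * L ^ b') ^ k = 2 ^ k * L ^ (b' * k) := by
      rw [mul_pow, ← Real.rpow_natCast (L ^ b') k, ← Real.rpow_mul hL0.le]
    have h5 : 1 ≤ L ^ (b' * k) := Real.one_le_rpow (by
      have : (1 : ℝ) ≤ 2 := one_le_two
      have h1L : 1 ≤ L ^ b' := le_trans this h2
      by_contra hcon
      push Not at hcon
      have : L ^ b' < 1 := Real.rpow_lt_one hL0.le hcon hb'0
      linarith) (by positivity)
    have hk1 : (0 : ℝ) ≤ k + 1 := by positivity
    calc (k + 1 : ℝ) * (L ^ b' + 2) ^ k ≤ (k + 1) * (2 ^ k * L ^ (b' * k)) := by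
          rw [← h4]; exact mul_le_mul_of_nonneg_left h3 hk1
      _ = ((k + 1) * 2 ^ k) * L ^ (b' * k) := by ring
      _ ≤ ((k + 1) * 2 ^ k + η / 40) * L ^ (b' * k) - η / 40 := by nlinarith only [h5, hη0]
      _ ≤ η / 40 * L ^ A - η / 40 := by linarith
      _ = η / 40 * (L ^ A - 1) := by ring
  have Q9 : ∀ᶠ L : ℝ in atTop, 1 ≤ L := eventually_ge_atTop 1
  -- transport to `N`
  have hlogN : Tendsto (fun N : ℕ ↦ Real.log N) atTop atTop :=
    Real.tendsto_log_atTop.comp tendsto_natCast_atTop_atTop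
  have hQ := hlogN.eventually (Q1.and (Q2.and (Q3.and (Q4.and (Q5.and (Q6.and (Q7.and (Q8.and Q9))))))))
  have hNX : ∀ᶠ N : ℕ in atTop, X₀ ≤ (N : ℝ) := tendsto_natCast_atTop_atTop.eventually_ge_atTop X₀
  filter_upwards [hQ, hNX] with N hQN hNX₀
  obtain ⟨q1, ⟨q2a, q2b, q2c, q2d⟩, q3, q4, q5, q6, q7, ⟨q8, q8b⟩, q9⟩ := hQN
  intro h hh1 hhup hhlow
  -- ### the basic quantities at `N`
  set L : ℝ := Real.log N with hLdef
  have hL1 : 1 ≤ L := q9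
  have hL0 : 0 < L := by linarith
  have hN1 : (1 : ℝ) < N := by
    by_contra hcon
    push Not at hcon
    have : L ≤ 0 := by
      rw [hLdef]
      rcases (Nat.cast_nonneg N : (0 : ℝ) ≤ N).eq_or_lt with h0 | h0
      · rw [← h0, Real.log_zero]
      · exact Real.log_nonpos h0.le hcon
    linarith
  have hN0 : (0 : ℝ) < N := by linarith
  have hNnat : 2 ≤ N := by exact_mod_cast (show (1 : ℝ) < N from hN1)
  have hexpL : Real.exp L = N := by rw [hLdef, Real.exp_log hN0]
  set y : ℝ := L ^ b' with hydef
  set w : ℝ := L ^ c with hwdef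
  have hw1 : 1 ≤ w := q2d
  have hw0 : 0 < w := by linarith
  have hwy : w ≤ y := by
    rw [hwdef, hydef]; exact Real.rpow_le_rpow_of_exponent_le hL1 hcb'.le
  have hy0 : 0 ≤ y := by linarith
  -- ### the exceptional primes at `N` and `2N`
  obtain ⟨B₁, hB₁, hPNT1⟩ := hX₀ N hNX₀
  obtain ⟨B₂, hB₂, hPNT2⟩ := hX₀ ((2 * N : ℕ) : ℝ) (by push_cast; linarith)
  -- ### the sieving set `S` and the modulus `P`
  set S₀ : Finset ℕ := Nat.primesLE ⌊y⌋₊ \ Nat.primesLE ⌊w⌋₊ with hS₀def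
  set S : Finset ℕ := (S₀.erase B₁).erase B₂ with hSdef
  have hSS₀ : S ⊆ S₀ := (erase_subset _ _).trans (erase_subset _ _)
  have hS₀prime : ∀ p ∈ S₀, p.Prime := fun p hp ↦
    Nat.prime_of_mem_primesLE (mem_sdiff.1 hp).1
  have hSprime : ∀ p ∈ S, p.Prime := fun p hp ↦ hS₀prime p (hSS₀ hp)
  have hS₀w : ∀ p ∈ S₀, w < p := by
    intro p hp
    obtain ⟨hp1, hp2⟩ := mem_sdiff.1 hp
    have hpp := Nat.prime_of_mem_primesLE hp1
    have : ¬ p ≤ ⌊w⌋₊ := fun hle ↦ hp2 (Nat.mem_primesLE.2 ⟨hle, hpp⟩)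
    exact (Nat.floor_lt hw0.le).1 (not_le.1 this)
  have hSw : ∀ p ∈ S, w < p := fun p hp ↦ hS₀w p (hSS₀ hp)
  have hS₀y : ∀ p ∈ S₀, (p : ℝ) ≤ y := fun p hp ↦
    (Nat.le_floor_iff hy0).1 (Nat.mem_primesLE.1 (mem_sdiff.1 hp).1).1
  have hB₁S : B₁ ∉ S := fun hB ↦ by
    have := mem_erase.1 hB; exact (mem_erase.1 this.2).1 rfl
  have hB₂S : B₂ ∉ S := fun hB ↦ (mem_erase.1 hB).1 rfl
  set P : ℕ := ∏ p ∈ S, p with hPdef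
  have hP0 : 0 < P := prod_pos fun p hp ↦ (hSprime p hp).pos
  have hPcop1 : P.Coprime B₁ := coprime_prod_of_notMem hSprime hB₁ hB₁S
  have hPcop2 : P.Coprime B₂ := coprime_prod_of_notMem hSprime hB₂ hB₂S
  -- `log P ≤ L^{b''} ≤ L/4`
  have hPprim : P ≤ 4 ^ ⌊y⌋₊ := by
    refine le_trans (Nat.le_of_dvd (primorial_pos _) ?_) (primorial_le_four_pow ⌊y⌋₊)
    exact prod_dvd_prod_of_subset _ _ _ (hSS₀.trans sdiff_subset)
  have hlogP : Real.log P ≤ L ^ b'' := by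
    have h1 : Real.log P ≤ ⌊y⌋₊ * Real.log 4 := by
      rw [← Real.log_pow]
      exact Real.log_le_log (by exact_mod_cast hP0) (by exact_mod_cast hPprim)
    have h2 : (⌊y⌋₊ : ℝ) ≤ y := Nat.floor_le hy0
    have h3 : (⌊y⌋₊ : ℝ) * Real.log 4 ≤ Real.log 4 * (y + 1) := by nlinarith only [h2, hlog4]
    linarith only [h1, h3, q1]
  have hlogP4 : Real.log P ≤ L / 4 := by linarith only [hlogP, q4]
  have hPexp : (P : ℝ) ≤ Real.exp (L / 4) := by
    have := Real.exp_le_exp.2 hlogP4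
    rwa [Real.exp_log (by exact_mod_cast hP0)] at this
  -- `P ≤ (ε/2) N`
  have hPεN : (P : ℝ) ≤ ε / 2 * N := by
    have h1 : Real.exp (L / 4) * (2 / ε) ≤ Real.exp (L / 4) * Real.exp (3 * L / 4) :=
      mul_le_mul_of_nonneg_left q5 (Real.exp_pos _).le
    rw [← Real.exp_add, show L / 4 + 3 * L / 4 = L by ring, hexpL] at h1
    have h2 : Real.exp (L / 4) ≤ ε / 2 * N := by
      have h3 := mul_le_mul_of_nonneg_right h1 (by positivity : (0 : ℝ) ≤ ε / 2)
      calc Real.exp (L / 4) = Real.exp (L / 4) * (2 / ε) * (ε / 2) := by field_simp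
        _ ≤ N * (ε / 2) := h3
        _ = ε / 2 * N := by ring
    exact hPexp.trans h2
  have hPε : (P : ℝ) ≤ ε * N := by nlinarith only [hPεN, hε0, hN0]
  have h2PN : 2 * P ≤ N := by
    have : 2 * (P : ℝ) ≤ N := by
      have hε1' : ε ≤ 1 := by linarith only [hε8]
      nlinarith only [hPεN, hε1', hN0]
    exact_mod_cast this
  -- `habs`
  have habs : (Nat.totient P : ℝ) * (3 * Real.sqrt (3 * N) * Real.log (3 * N)) ≤ ε * N := by
    have hφ : (Nat.totient P : ℝ) ≤ Real.exp (L / 4) :=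
      le_trans (by exact_mod_cast Nat.totient_le P) hPexp
    have hsqN : Real.sqrt N = Real.exp (L / 2) := by
      rw [Real.sqrt_eq_iff_mul_self_eq_of_pos (Real.exp_pos _), ← Real.exp_add, add_halves, hexpL]
    have hsq : Real.sqrt (3 * N) = Real.sqrt 3 * Real.exp (L / 2) := by
      rw [Real.sqrt_mul (by norm_num), hsqN]
    have hlog3N : Real.log (3 * N) = L + Real.log 3 := by
      rw [Real.log_mul (by norm_num) hN0.ne', hLdef]; ring
    rw [hsq, hlog3N]
    have hpos : 0 ≤ 3 * (Real.sqrt 3 * Real.exp (L / 2)) * (L + Real.log 3) := by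
      have : 0 ≤ Real.log 3 := Real.log_nonneg (by norm_num)
      positivity
    calc (Nat.totient P : ℝ) * (3 * (Real.sqrt 3 * Real.exp (L / 2)) * (L + Real.log 3))
        ≤ Real.exp (L / 4) * (3 * (Real.sqrt 3 * Real.exp (L / 2)) * (L + Real.log 3)) :=
          mul_le_mul_of_nonneg_right hφ hpos
      _ = Real.exp (3 * L / 4) * (3 * Real.sqrt 3 * (L + Real.log 3)) := by
          have : Real.exp (3 * L / 4) = Real.exp (L / 4) * Real.exp (L / 2) := by
            rw [← Real.exp_add]; congr 1; ring
          rw [this]; ring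
      _ ≤ Real.exp (3 * L / 4) * (ε * Real.exp (L / 4)) := mul_le_mul_of_nonneg_left q6 (Real.exp_pos _).le
      _ = ε * N := by
          rw [← hexpL, show ε * Real.exp L = ε * (Real.exp (3 * L / 4) * Real.exp (L / 4)) by
            rw [← Real.exp_add]; congr 2; ring]
          ring
  -- ### the prime number theorem for the modulus `P` at `N` and `2N`
  have hP1 : 1 ≤ P := hP0
  have hPNT1' : ∀ j : ℕ, j.Coprime P →
      |chebyshevPsiMod P (j : ZMod P) N - N / Nat.totient P| ≤ ε * (N / Nat.totient P) := by
    intro j hj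
    have := hPNT1 P hP1 (by rw [← hLdef]; exact hlogP) hPcop1 (ZMod.unitOfCoprime j hj)
    rwa [ZMod.coe_unitOfCoprime] at this
  have hPNT2' : ∀ j : ℕ, j.Coprime P →
      |chebyshevPsiMod P (j : ZMod P) ((2 * N : ℕ) : ℝ) - 2 * N / Nat.totient P| ≤
        ε * (2 * N / Nat.totient P) := by
    intro j hj
    have hlog2N : Real.log P ≤ Real.log ((2 * N : ℕ) : ℝ) ^ b'' := by
      refine hlogP.trans (Real.rpow_le_rpow hL0.le ?_ hb''0.le)
      rw [hLdef]; push_cast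
      exact Real.log_le_log hN0 (by linarith)
    have := hPNT2 P hP1 hlog2N hPcop2 (ZMod.unitOfCoprime j hj)
    rw [ZMod.coe_unitOfCoprime] at this
    push_cast at this ⊢
    exact this
  -- ### the sieve side: `s = ∑_{p ∈ S} 1/p`, `W = W(S)`, `e_{k+1}(S) ≥ η`
  have hs₀ : ∑ p ∈ S₀, (p : ℝ)⁻¹ =
      Literature.NumberTheory.LFunctions.Mertens.primeRecipSum y -
        Literature.NumberTheory.LFunctions.Mertens.primeRecipSum w := by
    unfold Literature.NumberTheory.LFunctions.Mertens.primeRecipSum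
    rw [hS₀def, sum_sdiff_eq_sub]
    intro p hp
    rw [Nat.mem_primesLE] at hp ⊢
    exact ⟨hp.1.trans (Nat.floor_mono hwy), hp.2⟩
  have hs₀bounds : ℓ - ℓ / 8 ≤ ∑ p ∈ S₀, (p : ℝ)⁻¹ ∧ ∑ p ∈ S₀, (p : ℝ)⁻¹ ≤ ℓ + ℓ / 8 := by
    rw [hs₀]; rw [abs_le] at q7; constructor <;> linarith
  set sS : ℝ := ∑ p ∈ S, (p : ℝ)⁻¹ with hsSdef
  have hsS : ℓ - ℓ / 8 - 2 * w⁻¹ ≤ sS ∧ sS ≤ ℓ + ℓ / 8 := by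
    have h1 := sum_inv_erase_ge hw0 hS₀w B₁
    have h2 := sum_inv_erase_ge (T := S₀.erase B₁) hw0 (fun p hp ↦ hS₀w p (erase_subset _ _ hp)) B₂
    rw [← hSdef] at h2
    constructor <;> linarith [hs₀bounds.1, hs₀bounds.2, h1.1, h1.2, h2.1, h2.2]
  have hwinv : w⁻¹ ≤ ℓ / 16 := by
    rw [inv_le_comm₀ hw0 (by positivity)]
    calc (ℓ / 16)⁻¹ = 16 / ℓ := by rw [inv_div]
      _ ≤ w := q2b
  have hkw : (k : ℝ) * w⁻¹ ≤ ℓ / 4 := by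
    rw [← div_eq_mul_inv, div_le_iff₀ hw0]
    have := (div_le_iff₀ hℓ0).1 (show 4 * (k : ℝ) / ℓ ≤ w from q2c)
    linarith
  have hW := one_sub_sum_le_sieveDensity S
  have hW5 : 1 / 5 ≤ sieveDensity S := by
    rw [← hsSdef] at hW; linarith [hsS.2]
  obtain ⟨hW0, hW1⟩ := sieveDensity_nonneg_le_one S
  have heS : η ≤ eSymm S (k + 1) := by
    have hm : ∀ p ∈ S, (p : ℝ)⁻¹ ≤ w⁻¹ := fun p hp ↦ by
      rw [inv_le_inv₀ (lt_trans hw0 (hSw p hp)) hw0]; exact (hSw p hp).le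
    have h1 := pow_div_factorial_le_eSymm S (inv_nonneg.2 hw0.le) hm (k + 1)
    refine le_trans ?_ h1
    rw [hηdef, eSymm_one, ← hsSdef]
    push_cast
    simp only [add_sub_cancel_right]
    refine div_le_div_of_nonneg_right (pow_le_pow_left₀ (by positivity) ?_ _) (by positivity)
    refine le_trans ?_ (le_max_left _ _)
    linarith [hsS.1]
  -- `#S ≥ k + 1`, so `P > w^{k+1} ≥ h`
  have hcardS : (k : ℝ) + 1 ≤ #S := by
    have h1 : sS ≤ #S * w⁻¹ := by
      rw [hsSdef]
      calc ∑ p ∈ S, (p : ℝ)⁻¹ ≤ ∑ p ∈ S, w⁻¹ := sum_le_sum fun p hp ↦ by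
            rw [inv_le_inv₀ (lt_trans hw0 (hSw p hp)) hw0]; exact (hSw p hp).le
        _ = #S * w⁻¹ := by rw [sum_const, nsmul_eq_mul]
    have h2 : ℓ / 2 ≤ sS := by linarith [hsS.1]
    have h3 : ℓ / 2 * w ≤ #S := by
      have := mul_le_mul_of_nonneg_right (h2.trans h1) hw0.le
      rwa [mul_assoc, inv_mul_cancel₀ hw0.ne', mul_one] at this
    have h4 : (2 * (k + 3) / ℓ) * (ℓ / 2) ≤ w * (ℓ / 2) := mul_le_mul_of_nonneg_right q2a (by positivity)
    have h5 : (2 * (k + 3) / ℓ) * (ℓ / 2) = k + 3 := by field_simp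
    linarith only [h3, h4, h5]
  have hSne : S.Nonempty := by
    rw [← card_pos]
    have : (0 : ℝ) < #S := by linarith
    exact_mod_cast this
  have hhw : (h : ℝ) ≤ w ^ (k + 1) := by
    refine hhup.trans (q3.trans (le_of_eq ?_))
    rw [hwdef, ← Real.rpow_natCast, ← Real.rpow_mul hL0.le]
    push_cast; ring_nf
  have hhP : h < P := by
    have h1 : w ^ #S < ∏ p ∈ S, (p : ℝ) := by
      rw [← prod_const]
      exact prod_lt_prod_of_nonempty (fun p _ ↦ hw0) (fun p hp ↦ hSw p hp) hSne
    have h2 : w ^ (k + 1) ≤ w ^ #S := pow_le_pow_right₀ hw1 (by exact_mod_cast hcardS)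
    have h3 : (h : ℝ) < ((∏ p ∈ S, p : ℕ) : ℝ) := by
      rw [Nat.cast_prod]; linarith
    exact_mod_cast h3
  -- the error term
  have hErr : (k + 1 : ℝ) * (#S + 1) ^ k ≤ η / 40 * h := by
    have h1 : (#S : ℝ) ≤ y + 1 := by
      have : #S ≤ ⌊y⌋₊ + 1 := by
        calc #S ≤ #(Nat.primesLE ⌊y⌋₊) := card_le_card (hSS₀.trans sdiff_subset)
          _ ≤ #(range (⌊y⌋₊ + 1)) := card_le_card (filter_subset _ _)
          _ = ⌊y⌋₊ + 1 := card_range _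
      have h2 : (⌊y⌋₊ : ℝ) ≤ y := Nat.floor_le hy0
      calc (#S : ℝ) ≤ ((⌊y⌋₊ + 1 : ℕ) : ℝ) := by exact_mod_cast this
        _ = ⌊y⌋₊ + 1 := by push_cast; ring
        _ ≤ y + 1 := by linarith
    have h2 : ((#S : ℝ) + 1) ^ k ≤ (y + 2) ^ k := pow_le_pow_left₀ (by positivity) (by linarith) k
    have hk1 : (0 : ℝ) ≤ k + 1 := by positivity
    calc (k + 1 : ℝ) * (#S + 1) ^ k ≤ (k + 1) * (y + 2) ^ k := mul_le_mul_of_nonneg_left h2 hk1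
      _ ≤ η / 40 * (L ^ A - 1) := q8
      _ ≤ η / 40 * h := mul_le_mul_of_nonneg_left hhlow (by positivity)
  -- `N_c = siftedCount S h` and `P/φ(P) = 1/W`
  have hNc : (#{i ∈ range h | (i + 1).Coprime P} : ℝ) = siftedCount S h := by
    rw [card_range_filter_succ h (fun j ↦ j.Coprime P), siftedCount_eq_card_coprime S hSprime]
  have hPW : (P : ℝ) / Nat.totient P = (sieveDensity S)⁻¹ := by
    rw [sieveDensity_eq_totient_div S hSprime, inv_div]
  have hWpos : 0 < sieveDensity S := by linarith
  have hh0 : (0 : ℝ) < h := by exact_mod_cast hh1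
  have hlog3N : 0 < Real.log (3 * N) := Real.log_pos (by linarith)
  have hlogN0 : 0 < Real.log N := Real.log_pos hN1
  -- rows `x = rP ∈ (N, 2N]`
  have hrow : ∀ r ∈ Ioc (N / P) (2 * N / P), N < r * P ∧ r * P ≤ 2 * N := by
    intro r hr
    rw [mem_Ioc] at hr
    constructor
    · have h1 : N < N / P * P + P := Nat.lt_div_mul_add hP0
      have h2 : (N / P + 1) * P ≤ r * P := Nat.mul_le_mul_right P hr.1
      have h3 : (N / P + 1) * P = N / P * P + P := by ring
      calc N < N / P * P + P := h1
        _ = (N / P + 1) * P := h3.symm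
        _ ≤ r * P := h2
    · exact (Nat.mul_le_mul_right P hr.2).trans (Nat.div_mul_le_self _ _)
  constructor
  · -- ### even `k`: a row with many primes
    intro hkeven
    obtain ⟨r, hr, hge⟩ := exists_row_ge hP0 hhP h2PN hε0 hε8 hPε habs hPNT1' hPNT2'
    refine ⟨r * P, (hrow r hr).1, (hrow r hr).2, le_trans ?_ hge⟩
    rw [hNc, hPW]
    have hsift := siftedCount_ge_of_even S hSprime hw1 hSw h k hkeven hhw
    have hend := even_endgame hh0 hη0 hη1 hW5 heS hErr hsift
    rw [hεdef]
    exact div_le_div_of_nonneg_right hend hlog3N.le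
  · -- ### odd `k`: a row with few primes
    intro hkodd
    obtain ⟨r, hr, hle⟩ := exists_row_le hP0 hhP h2PN hε0 hε8 hPε habs hPNT1' hPNT2'
    refine ⟨r * P, (hrow r hr).1, (hrow r hr).2, hle.trans ?_⟩
    rw [hNc, hPW]
    have hsift := siftedCount_le_of_odd S hSprime hw1 hSw h k hkodd hhw
    have hend := odd_endgame hh0 hη0 hW5 heS hErr hsift
    rw [hεdef]
    exact div_le_div_of_nonneg_right hend hlogN0.le

end Literature.Barriers.Parity.Maier

namespace Literature.Barriers.Parity

open Literature.Barriers.Parity.Maier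

/-- **Maier's theorem (1985), PROVED**: for every `A > 2` there is `δ_A > 0` such that
`π(x + log^A x) − π(x) ≥ (1 + δ_A) log^{A−1} x` for arbitrarily large integers `x` and
`π(X + log^A X) − π(X) ≤ (1 − δ_A) log^{A−1} X` for arbitrarily large integers `X`
(the named fact `Maier1985_shortIntervals`, in the form printed by Granville 2010, §4 p. 12).
Proof: `Maier.matrix_rows` with `k = 4⌈A⌉ + 2` (even, excess, width `h = ⌊log^A N⌋`) and
`k = 4⌈A⌉ + 3` (odd, deficit, width `h = ⌈log^A(2N)⌉`), and the comparison
`Maier.eventually_lengths_le` of `h/log N` with `log^{A−1} x` for `x ∈ (N, 2N]`.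
[cite: Maier1985, Theorem] [cite: Granville2010DifferentApproaches, §4 (p. 12)] -/
theorem Maier1985_shortIntervals_holds : Maier1985_shortIntervals := by
  intro A hA
  have hA0 : 0 < A := by linarith
  set m : ℕ := ⌈A⌉₊ with hm
  have hmA : A ≤ m := Nat.le_ceil A
  obtain ⟨η₁, hη₁0, hη₁1, hev₁⟩ := matrix_rows hA (k := 4 * m + 2) (by push_cast; linarith)
  obtain ⟨η₂, hη₂0, hη₂1, hev₂⟩ := matrix_rows hA (k := 4 * m + 3) (by push_cast; linarith)
  have hlog2 : 0 < Real.log 2 := Real.log_pos one_lt_two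
  have hlog3 : 0 < Real.log 3 := Real.log_pos (by norm_num)
  have hlog21 : Real.log 2 < 1 := by linarith [log_two_lt]
  have hlogN : Tendsto (fun N : ℕ ↦ Real.log N) atTop atTop :=
    Real.tendsto_log_atTop.comp tendsto_natCast_atTop_atTop
  refine ⟨min (η₁ / 16) (η₂ / 16), lt_min (by positivity) (by positivity), ?_, ?_⟩
  · -- ### excess
    rw [frequently_atTop]
    intro M
    have hκ : 1 < (1 + η₁ / 4) / (1 + η₁ / 16) := by
      rw [one_lt_div (by positivity)]; linarith
    have hE := hlogN.eventually ((eventually_lengths_le hlog2.le hlog3.le hA0 hκ).and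
      (eventually_ge_atTop (2 : ℝ)))
    obtain ⟨N, hN, ⟨hlen, hL2⟩, hNM⟩ := (hev₁.and (hE.and (eventually_ge_atTop M))).exists
    set L : ℝ := Real.log N with hLdef
    have hL0 : 0 < L := by linarith
    have hLA1 : 1 < L ^ A := Real.one_lt_rpow (by linarith) hA0
    have hLA0 : 0 ≤ L ^ A := by linarith
    set h : ℕ := ⌊L ^ A⌋₊ with hhdef
    have hhle : (h : ℝ) ≤ L ^ A := Nat.floor_le hLA0
    have hhge : L ^ A - 1 ≤ h := (Nat.sub_one_lt_floor _).le
    have hh1 : 1 ≤ h := Nat.le_floor (by simpa using hLA1.le)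
    have hhup : (h : ℝ) ≤ (L + 1) ^ A + 1 := by
      have : L ^ A ≤ (L + 1) ^ A := Real.rpow_le_rpow hL0.le (by linarith) hA0.le
      linarith
    obtain ⟨x, hNx, hx2N, hcount⟩ := (hN h hh1 hhup hhge).1 ⟨2 * m + 1, by ring⟩
    refine ⟨x, le_of_lt (lt_of_le_of_lt hNM hNx), ?_⟩
    -- sizes at `x`
    have hN0 : (0 : ℝ) < N := by
      rcases Nat.eq_zero_or_pos N with hz | hpos
      · exfalso
        rw [hLdef, hz, Nat.cast_zero, Real.log_zero] at hL0
        exact lt_irrefl _ hL0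
      · exact_mod_cast hpos
    have hx0 : (0 : ℝ) < x := by exact_mod_cast (lt_of_le_of_lt (Nat.zero_le N) hNx)
    have hLx : L ≤ Real.log x := Real.log_le_log hN0 (by exact_mod_cast hNx.le)
    have hlogx0 : 0 < Real.log x := by linarith
    have hx2 : Real.log x ≤ L + Real.log 2 := by
      rw [hLdef, ← Real.log_mul (by positivity) two_ne_zero, mul_comm]
      exact Real.log_le_log hx0 (by exact_mod_cast hx2N)
    have hlog3N : Real.log (3 * N) = L + Real.log 3 := by
      rw [Real.log_mul (by norm_num) hN0.ne', hLdef, add_comm]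
    -- `h ≤ (log x)^A`, so the row count is at most `primesInInterval x (log^A x)`
    have hmono : (#{i ∈ range h | (x + (i + 1)).Prime} : ℝ) ≤ primesInInterval x (Real.log x ^ A) := by
      rw [← primesInInterval_natCast]
      exact_mod_cast primesInInterval_mono x (hhle.trans (Real.rpow_le_rpow hL0.le hLx hA0.le))
    refine le_trans ?_ (hcount.trans hmono)
    -- `(1+δ) log^{A-1} x ≤ h (1 + η₁/4)/log(3N)`
    rw [Real.rpow_sub_one hlogx0.ne', hlog3N]
    have hlog23 : 0 < L + Real.log 3 := by linarith
    have hB1 : (1 + η₁ / 16) * ((L + Real.log 2) ^ A * (L + Real.log 3)) ≤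
        (1 + η₁ / 4) * ((L ^ A - 1) * L) := by
      have hlen' : (L + Real.log 2) ^ A * (L + Real.log 3) ≤
          (1 + η₁ / 4) / (1 + η₁ / 16) * ((L ^ A - 1) * L) := by
        refine le_trans ?_ hlen
        nlinarith [Real.rpow_nonneg (by linarith : 0 ≤ L + Real.log 2) A]
      have := mul_le_mul_of_nonneg_left hlen' (by positivity : 0 ≤ 1 + η₁ / 16)
      calc (1 + η₁ / 16) * ((L + Real.log 2) ^ A * (L + Real.log 3))
          ≤ (1 + η₁ / 16) * ((1 + η₁ / 4) / (1 + η₁ / 16) * ((L ^ A - 1) * L)) := this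
        _ = (1 + η₁ / 4) * ((L ^ A - 1) * L) := by field_simp
    have h1 : min (η₁ / 16) (η₂ / 16) ≤ η₁ / 16 := min_le_left _ _
    have hδ0 : 0 ≤ min (η₁ / 16) (η₂ / 16) := le_min (by positivity) (by positivity)
    have hxA : Real.log x ^ A ≤ (L + Real.log 2) ^ A := Real.rpow_le_rpow hlogx0.le hx2 hA0.le
    have hL2A0 : 0 ≤ (L + Real.log 2) ^ A := Real.rpow_nonneg (by linarith) A
    calc (1 + min (η₁ / 16) (η₂ / 16)) * (Real.log x ^ A / Real.log x)
        ≤ (1 + η₁ / 16) * ((L + Real.log 2) ^ A / L) :=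
          mul_le_mul (by linarith) (div_le_div₀ hL2A0 hxA hL0 hLx) (by positivity) (by positivity)
      _ = (1 + η₁ / 16) * ((L + Real.log 2) ^ A * (L + Real.log 3)) / (L * (L + Real.log 3)) := by
          field_simp
      _ ≤ (1 + η₁ / 4) * ((L ^ A - 1) * L) / (L * (L + Real.log 3)) :=
          div_le_div_of_nonneg_right hB1 (by positivity)
      _ = (L ^ A - 1) * (1 + η₁ / 4) / (L + Real.log 3) := by field_simp
      _ ≤ h * (1 + η₁ / 4) / (L + Real.log 3) := by
          refine div_le_div_of_nonneg_right ?_ hlog23.le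
          exact mul_le_mul_of_nonneg_right hhge (by positivity)
  · -- ### deficit
    rw [frequently_atTop]
    intro M
    have hκ : 1 < (1 - η₂ / 16) / (1 - η₂ / 4) := by
      rw [one_lt_div (by linarith)]; linarith
    have hE := hlogN.eventually ((eventually_lengths_le hlog2.le hlog2.le hA0 hκ).and
      (eventually_ge_atTop (2 : ℝ)))
    obtain ⟨N, hN, ⟨hlen, hL2⟩, hNM⟩ := (hev₂.and (hE.and (eventually_ge_atTop M))).exists
    set L : ℝ := Real.log N with hLdef
    have hL0 : 0 < L := by linarith
    have hLA1 : 1 < L ^ A := Real.one_lt_rpow (by linarith) hA0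
    have hL2A0 : 0 ≤ (L + Real.log 2) ^ A := Real.rpow_nonneg (by linarith) A
    set h : ℕ := ⌈(L + Real.log 2) ^ A⌉₊ with hhdef
    have hhge' : (L + Real.log 2) ^ A ≤ h := Nat.le_ceil _
    have hhlt : (h : ℝ) < (L + Real.log 2) ^ A + 1 := Nat.ceil_lt_add_one hL2A0
    have hLA2 : L ^ A ≤ (L + Real.log 2) ^ A := Real.rpow_le_rpow hL0.le (by linarith) hA0.le
    have hhge : L ^ A - 1 ≤ h := by linarith
    have hh1 : 1 ≤ h := by
      have : (1 : ℝ) ≤ h := by linarith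
      exact_mod_cast this
    have hhup : (h : ℝ) ≤ (L + 1) ^ A + 1 := by
      have : (L + Real.log 2) ^ A ≤ (L + 1) ^ A := Real.rpow_le_rpow (by linarith) (by linarith) hA0.le
      linarith
    obtain ⟨x, hNx, hx2N, hcount⟩ := (hN h hh1 hhup hhge).2 ⟨2 * m + 1, by ring⟩
    refine ⟨x, le_of_lt (lt_of_le_of_lt hNM hNx), ?_⟩
    have hN0 : (0 : ℝ) < N := by
      rcases Nat.eq_zero_or_pos N with hz | hpos
      · exfalso
        rw [hLdef, hz, Nat.cast_zero, Real.log_zero] at hL0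
        exact lt_irrefl _ hL0
      · exact_mod_cast hpos
    have hx0 : (0 : ℝ) < x := by exact_mod_cast (lt_of_le_of_lt (Nat.zero_le N) hNx)
    have hLx : L ≤ Real.log x := Real.log_le_log hN0 (by exact_mod_cast hNx.le)
    have hlogx0 : 0 < Real.log x := by linarith
    have hx2 : Real.log x ≤ L + Real.log 2 := by
      rw [hLdef, ← Real.log_mul (by positivity) two_ne_zero, mul_comm]
      exact Real.log_le_log hx0 (by exact_mod_cast hx2N)
    -- `(log x)^A ≤ h`, so `primesInInterval x (log^A x)` is at most the row count
    have hmono : (primesInInterval x (Real.log x ^ A) : ℝ) ≤ #{i ∈ range h | (x + (i + 1)).Prime} := by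
      rw [← primesInInterval_natCast]
      exact_mod_cast primesInInterval_mono x
        ((Real.rpow_le_rpow hlogx0.le hx2 hA0.le).trans hhge')
    refine hmono.trans (hcount.trans ?_)
    -- `h (1 − η₂/4)/L ≤ (1 − δ) log^{A−1} x`
    rw [Real.rpow_sub_one hlogx0.ne']
    have h14 : 0 < 1 - η₂ / 4 := by linarith
    have hlog22 : 0 < L + Real.log 2 := by linarith
    have hA1 : (h : ℝ) * (1 - η₂ / 4) ≤ (1 - η₂ / 16) * L ^ A * L / (L + Real.log 2) := by
      have hlen' : ((L + Real.log 2) ^ A + 1) * (L + Real.log 2) ≤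
          (1 - η₂ / 16) / (1 - η₂ / 4) * (L ^ A * L) := by
        refine hlen.trans (mul_le_mul_of_nonneg_left ?_ (by positivity))
        nlinarith
      have h2 := mul_le_mul_of_nonneg_right hlen' h14.le
      rw [le_div_iff₀ hlog22]
      calc (h : ℝ) * (1 - η₂ / 4) * (L + Real.log 2)
          ≤ ((L + Real.log 2) ^ A + 1) * (1 - η₂ / 4) * (L + Real.log 2) := by
            refine mul_le_mul_of_nonneg_right (mul_le_mul_of_nonneg_right hhlt.le h14.le) hlog22.le
        _ = ((L + Real.log 2) ^ A + 1) * (L + Real.log 2) * (1 - η₂ / 4) := by ring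
        _ ≤ (1 - η₂ / 16) / (1 - η₂ / 4) * (L ^ A * L) * (1 - η₂ / 4) := h2
        _ = (1 - η₂ / 16) * L ^ A * L := by
            have h4ne : (4 : ℝ) - η₂ ≠ 0 := by linarith
            field_simp
    have h1 : min (η₁ / 16) (η₂ / 16) ≤ η₂ / 16 := min_le_right _ _
    have hxA : L ^ A ≤ Real.log x ^ A := Real.rpow_le_rpow hL0.le hLx hA0.le
    have hxA0 : 0 ≤ Real.log x ^ A := Real.rpow_nonneg hlogx0.le A
    calc (h : ℝ) * (1 - η₂ / 4) / L ≤ ((1 - η₂ / 16) * L ^ A * L / (L + Real.log 2)) / L :=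
          div_le_div_of_nonneg_right hA1 hL0.le
      _ = (1 - η₂ / 16) * (L ^ A / (L + Real.log 2)) := by field_simp
      _ ≤ (1 - η₂ / 16) * (Real.log x ^ A / Real.log x) :=
          mul_le_mul_of_nonneg_left (div_le_div₀ hxA0 hxA hlogx0 hx2) (by linarith)
      _ ≤ (1 - min (η₁ / 16) (η₂ / 16)) * (Real.log x ^ A / Real.log x) :=
          mul_le_mul_of_nonneg_right (by linarith) (by positivity)

end Literature.Barriers.Parity
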